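import Summits.NavierStokesRegularity.FluidComputer.ClayBlowupZoomHalfPlane
import Literature.Analysis.FluidPDE.AxisymmetricVorticityTransport
import Literature.Analysis.FluidPDE.AxisymNoSwirlVorticity
import Literature.Analysis.FluidPDE.AncientMildWeakStar
import Literature.Analysis.FluidPDE.LeiZhang2011RegularityOfSwirlStep
import HarnessLib

/-!
# AXIS ZOOM DATA for an axisymmetric Clay blow-up WITH force: running maxima of
# `(r' − |y − x₁|)² · |y'| · ‖u(τ, y)‖` (KNSS 2009, proof of Thm 6.2, LOCALISED)

Cell `ns-blowup`, seat `ns-blowup-ecbridge-2` (g12; the E–C endpoint theory seat). LABEL: E–C typing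
(KERNEL — no named fact, no new definition). WHAT THIS IS NOT: not Navier–Stokes evidence — a
selection lemma about the TYPE `ClayBlowup ν`; no inhabitant is claimed. Companion memo:
`run/shared/lean/pub/ns-blowup/ecbridge2/ECBRIDGE-2-MEMO-11.md`.

## Content

Koch–Nadirashvili–Seregin–Šverák prove Theorem 6.2 (axisymmetric, `|u| ≤ C/√(T − t)` ⇒ bounded)
by showing first that `f = |x'| |u|` is bounded, through a blow-up sequence at the running maxima
of `f` (Acta Math. 203 (2009), arXiv p. 13). To run the argument NEAR ONE AXIS POINT `x₁` of a
forced blow-up — where `f` need not be bounded on any slab — we maximise, over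
`[t_b, s] × B̄(x₁, r')`, the weighted quantity `Φ(τ, y) = (r' − |y − x₁|)² · |y'| · ‖u(τ, y)‖`
(g11's squared distance weight, `ClayBlowupLocalZoomData.lean`, times KNSS's `|x'|`): at a maximiser
`(τ, y)` with `d = r' − |y − x₁|`, `M = |y'| ‖u(τ, y)‖`, maximality gives KNSS's bound
`|z'| ‖u(s, z)‖ ≤ 4M` on `[t_b, τ] × B(y, d/2)` — the source of (wkbound), (wkbound2) — while the
squared weight makes, in the zoom of scale `‖u(τ, y)‖⁻¹`, the good radius `d ‖u(τ,y)‖/2 → ∞` AND the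
energy-paid far-field budget `∝ (d⁴ ‖u(τ,y)‖³)⁻¹ → 0`. With `x₁` ON the axis and axisymmetric
slices the maximiser may be rotated onto the meridian half-plane `{y₁ = 0, y₀ ≥ 0}` (so that the
zoomed axis passes through `−M e₀`, `zoom_halfPlane_rot_about`).

* `ClayBlowup.exists_axisWeighted_max` — one maximiser above any level, given that `|x'|‖u‖` is
  unbounded on `[t_b, T) × B(x₁, r'/2)`;
* `ClayBlowup.exists_axisWeighted_max_halfPlane` — the same with `y₁ = 0 ≤ y₀` (axis point `x₁`,
  axisymmetric slices);
* `ClayBlowup.cylRadius_mul_norm_le_four_mul` — KNSS's bound `|z'|‖u(s,z)‖ ≤ 4M` on the half ball;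
* `ClayBlowup.exists_axis_zoom_data` — the sequence: `(k+1) ≤ d_k² · r_k · ‖u(τ_k, y_k)‖`,
  `y_k` on the half-plane, `0 < r_k = (y_k)₀ ≤ ‖y_k − x₁‖ < r'`, maximality and the `4M_k` bound.

References: Koch–Nadirashvili–Seregin–Šverák, Acta Math. 203 (2009), proof of Thm 6.2
[cite: KochNadirashviliSereginSverak2009, proof of Thm 6.2 (arXiv pp. 12–13)]; C. L. Fefferman, (C)
[cite: FeffermanClay2006, (C)].
-/

noncomputable section

namespace Summit.NavierStokesRegularity.FluidComputer

open Set MeasureTheory Filter Topology Function Metric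
open scoped ENNReal NNReal
open Literature.Analysis Literature.Analysis.FluidPDE
open Summit.NavierStokesRegularity.NavierStokesRegularity

/-! ## §0 Small geometry of the axis -/

/-- For a point `x₁` ON the axis, `|z'| ≤ ‖z − x₁‖`. [folklore] -/
theorem cylRadius_le_norm_sub_of_axis {x₁ : EuclideanSpace ℝ (Fin 3)} (hx₁ : cylRadius x₁ = 0)
    (z : EuclideanSpace ℝ (Fin 3)) : cylRadius z ≤ ‖z - x₁‖ := by
  have h := cylRadius_le_cylRadius_add_norm_sub x₁ z
  rw [hx₁, zero_add] at h
  exact h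

/-- Rotations about the axis fix the distance to any axis point. [folklore] -/
theorem dist_rotZ_of_axis {x₁ : EuclideanSpace ℝ (Fin 3)} (hx₁ : cylRadius x₁ = 0) (θ : ℝ)
    (z : EuclideanSpace ℝ (Fin 3)) : dist (rotZ θ z) x₁ = dist z x₁ := by
  obtain ⟨h0, h1⟩ := (cylRadius_eq_zero_iff x₁).1 hx₁
  rw [dist_eq_norm, dist_eq_norm]
  conv_lhs => rw [← rotZ_eq_self_of_axis θ h0 h1]
  rw [← rotZL_apply, ← rotZL_apply, ← map_sub, rotZL_apply, norm_rotZ]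

namespace ClayBlowup

variable {ν : ℝ} (X : ClayBlowup ν)

/-! ## §1 One weighted maximum above any level -/

/-- **A maximiser of `(r' − |y − x₁|)² |y'| ‖u‖` above any prescribed level** (no named fact; any
`ν`): if `|x'| ‖u‖` is unbounded on `[t_b, T) × B(x₁, r'/2)`, then for every `L` there are
`τ ∈ [t_b, T)` and `y ∈ B(x₁, r')` at which `Φ(τ, y) ≥ L` and which maximise `Φ` over
`[t_b, τ] × B̄(x₁, r')` (compactness and continuity of the classical solution below `T`; KNSS choose
the running maxima of `|x'||u|` itself). [cite: KochNadirashviliSereginSverak2009, proof of Thm 6.2 (arXiv p. 13)] -/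
theorem exists_axisWeighted_max {x₁ : EuclideanSpace ℝ (Fin 3)} {r' t_b : ℝ} (hr' : 0 < r')
    (ht_b : t_b ∈ Ico 0 X.T)
    (hunb : ∀ L : ℝ, ∃ s ∈ Ico t_b X.T, ∃ z ∈ ball x₁ (r' / 2), L < cylRadius z * ‖X.u s z‖)
    (L : ℝ) :
    ∃ τ ∈ Ico t_b X.T, ∃ y ∈ ball x₁ r',
      L ≤ (r' - dist y x₁) ^ 2 * (cylRadius y * ‖X.u τ y‖) ∧
      ∀ s ∈ Icc t_b τ, ∀ z ∈ closedBall x₁ r',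
        (r' - dist z x₁) ^ 2 * (cylRadius z * ‖X.u s z‖) ≤
          (r' - dist y x₁) ^ 2 * (cylRadius y * ‖X.u τ y‖) := by
  have hT := X.T_pos
  -- ### a point where `|z'| ‖u‖` is large, well inside the ball
  obtain ⟨s, hs, z, hz, hsz⟩ := hunb ((max L 0 + 1) * (4 / r' ^ 2))
  have hwz : (r' / 2) ^ 2 ≤ (r' - dist z x₁) ^ 2 := by
    have h1 : dist z x₁ < r' / 2 := mem_ball.1 hz
    have h2 : r' / 2 ≤ r' - dist z x₁ := by linarith
    exact pow_le_pow_left₀ (by positivity) h2 2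
  have hΦz : max L 0 + 1 ≤ (r' - dist z x₁) ^ 2 * (cylRadius z * ‖X.u s z‖) := by
    have h1 : (max L 0 + 1) * (4 / r' ^ 2) * (r' / 2) ^ 2 = max L 0 + 1 := by
      field_simp
      ring
    calc max L 0 + 1 = (max L 0 + 1) * (4 / r' ^ 2) * (r' / 2) ^ 2 := h1.symm
      _ ≤ (cylRadius z * ‖X.u s z‖) * (r' - dist z x₁) ^ 2 :=
          mul_le_mul hsz.le hwz (by positivity)
            (mul_nonneg (cylRadius_nonneg _) (norm_nonneg _))
      _ = _ := mul_comm _ _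
  -- ### the maximiser on the compact set `[t_b, s] × B̄(x₁, r')`
  set K : Set (ℝ × EuclideanSpace ℝ (Fin 3)) := Icc t_b s ×ˢ closedBall x₁ r' with hK
  have hKc : IsCompact K := isCompact_Icc.prod (isCompact_closedBall _ _)
  have hzK : (s, z) ∈ K :=
    ⟨⟨hs.1, le_rfl⟩, ball_subset_closedBall (ball_subset_ball (by linarith) hz)⟩
  set Φ : ℝ × EuclideanSpace ℝ (Fin 3) → ℝ := fun q =>
    (r' - dist q.2 x₁) ^ 2 * (cylRadius q.2 * ‖X.u q.1 q.2‖) with hΦ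
  have hΦc : ContinuousOn Φ K := by
    have hu : ContinuousOn (fun q : ℝ × EuclideanSpace ℝ (Fin 3) => X.u q.1 q.2) K := by
      refine X.classical.smooth_velocity.continuousOn.mono fun q hq => ⟨?_, mem_univ _⟩
      exact ⟨ht_b.1.trans hq.1.1, lt_of_le_of_lt hq.1.2 hs.2⟩
    have hw : Continuous fun q : ℝ × EuclideanSpace ℝ (Fin 3) => (r' - dist q.2 x₁) ^ 2 := by
      fun_prop
    have hr : Continuous fun q : ℝ × EuclideanSpace ℝ (Fin 3) => cylRadius q.2 :=
      continuous_cylRadius.comp continuous_snd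
    exact hw.continuousOn.mul (hr.continuousOn.mul hu.norm)
  obtain ⟨q₀, hq₀K, hq₀max⟩ := hKc.exists_isMaxOn ⟨_, hzK⟩ hΦc
  obtain ⟨⟨hτ₁, hτ₂⟩, hy⟩ := hq₀K
  have hmax : ∀ q ∈ K, Φ q ≤ Φ q₀ := fun q hq => hq₀max hq
  have hL : max L 0 + 1 ≤ Φ q₀ := hΦz.trans (hmax (s, z) hzK)
  -- the maximiser lies in the OPEN ball (its weight is positive)
  have hyball : q₀.2 ∈ ball x₁ r' := by
    rw [mem_ball]
    by_contra h
    push Not at h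
    have h1 : r' - dist q₀.2 x₁ = 0 := by
      have := mem_closedBall.1 hy; linarith
    have : Φ q₀ = 0 := by simp only [hΦ, h1]; ring
    have h2 : (0 : ℝ) ≤ max L 0 := le_max_right _ _
    linarith
  refine ⟨q₀.1, ⟨hτ₁, lt_of_le_of_lt hτ₂ hs.2⟩, q₀.2, hyball, ?_, fun s' hs' z' hz' => ?_⟩
  · exact ((le_max_left L 0).trans (by linarith)).trans hL
  · exact hmax (s', z') ⟨⟨hs'.1, hs'.2.trans hτ₂⟩, hz'⟩

/-- **The maximiser may be taken on the meridian half-plane** when `x₁` is an axis point and the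
slices are axisymmetric: rotating `y` about the axis preserves `dist y x₁`, `|y'|` and `‖u(τ, y)‖`.
[cite: KochNadirashviliSereginSverak2009, proof of Thm 6.1 (arXiv p. 12)] -/
theorem exists_axisWeighted_max_halfPlane (hax : ∀ t ∈ Ico 0 X.T, IsAxisymmetric (X.u t))
    {x₁ : EuclideanSpace ℝ (Fin 3)} (hx₁ : cylRadius x₁ = 0) {r' t_b : ℝ} (hr' : 0 < r')
    (ht_b : t_b ∈ Ico 0 X.T)
    (hunb : ∀ L : ℝ, ∃ s ∈ Ico t_b X.T, ∃ z ∈ ball x₁ (r' / 2), L < cylRadius z * ‖X.u s z‖)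
    (L : ℝ) :
    ∃ τ ∈ Ico t_b X.T, ∃ y ∈ ball x₁ r', (y 1 = 0 ∧ 0 ≤ y 0) ∧
      L ≤ (r' - dist y x₁) ^ 2 * (cylRadius y * ‖X.u τ y‖) ∧
      ∀ s ∈ Icc t_b τ, ∀ z ∈ closedBall x₁ r',
        (r' - dist z x₁) ^ 2 * (cylRadius z * ‖X.u s z‖) ≤
          (r' - dist y x₁) ^ 2 * (cylRadius y * ‖X.u τ y‖) := by
  obtain ⟨τ, hτ, y, hy, hL, hmax⟩ := X.exists_axisWeighted_max hr' ht_b hunb L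
  obtain ⟨θ, hθ1, hθ0⟩ := exists_rotZ_mem_halfPlane y
  have hτT : τ ∈ Ico 0 X.T := ⟨ht_b.1.trans hτ.1, hτ.2⟩
  have hdist : dist (rotZ θ y) x₁ = dist y x₁ := dist_rotZ_of_axis hx₁ θ y
  have hnorm : ‖X.u τ (rotZ θ y)‖ = ‖X.u τ y‖ := by rw [hax τ hτT θ y, norm_rotZ]
  refine ⟨τ, hτ, rotZ θ y, ?_, ⟨hθ1, hθ0⟩, ?_, ?_⟩
  · rw [mem_ball, hdist]; exact mem_ball.1 hy
  · rw [hdist, cylRadius_rotZ, hnorm]; exact hL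
  · intro s hs z hz
    rw [hdist, cylRadius_rotZ, hnorm]; exact hmax s hs z hz

/-! ## §2 KNSS's bound off the maximiser -/

/-- **At a maximiser, `|z'| ‖u(s, z)‖ ≤ 4M` on the half-weight ball** (KNSS's `f ≤ M_k` for
`t ≤ t_k`, here with the factor `4` of the squared weight): if
`(r' − |z − x₁|)² |z'|‖u(s,z)‖ ≤ (r' − |y − x₁|)² |y'|‖u(τ,y)‖` on `[t_b, τ] × B̄(x₁, r')` and
`y ∈ B(x₁, r')`, then `|z'|‖u(s, z)‖ ≤ 4 |y'|‖u(τ, y)‖` for `s ∈ [t_b, τ]`, `z ∈ B(y, d/2)`,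
`d = r' − |y − x₁|`. [cite: KochNadirashviliSereginSverak2009, proof of Thm 6.2 (arXiv p. 13)] -/
theorem cylRadius_mul_norm_le_four_mul {x₁ y : EuclideanSpace ℝ (Fin 3)} {r' t_b τ : ℝ}
    (hy : y ∈ ball x₁ r')
    (hmax : ∀ s ∈ Icc t_b τ, ∀ z ∈ closedBall x₁ r',
      (r' - dist z x₁) ^ 2 * (cylRadius z * ‖X.u s z‖) ≤
        (r' - dist y x₁) ^ 2 * (cylRadius y * ‖X.u τ y‖))
    {s : ℝ} (hs : s ∈ Icc t_b τ) {z : EuclideanSpace ℝ (Fin 3)}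
    (hz : z ∈ ball y ((r' - dist y x₁) / 2)) :
    cylRadius z * ‖X.u s z‖ ≤ 4 * (cylRadius y * ‖X.u τ y‖) := by
  set d : ℝ := r' - dist y x₁ with hd
  have hd0 : 0 < d := sub_pos.2 (mem_ball.1 hy)
  have hzy : dist z y < d / 2 := mem_ball.1 hz
  have hwz : d / 2 < r' - dist z x₁ := by
    have : dist z x₁ ≤ dist z y + dist y x₁ := dist_triangle _ _ _
    rw [hd] at hzy ⊢; linarith
  have hzball : z ∈ closedBall x₁ r' := mem_closedBall.2 (by linarith [hd0])
  have h := hmax s hs z hzball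
  have hw2 : (d / 2) ^ 2 ≤ (r' - dist z x₁) ^ 2 := pow_le_pow_left₀ (by positivity) hwz.le 2
  have hd2 : 0 < (d / 2) ^ 2 := by positivity
  have h1 : (d / 2) ^ 2 * (cylRadius z * ‖X.u s z‖) ≤ d ^ 2 * (cylRadius y * ‖X.u τ y‖) :=
    (mul_le_mul_of_nonneg_right hw2 (mul_nonneg (cylRadius_nonneg _) (norm_nonneg _))).trans h
  have h2 : d ^ 2 * (cylRadius y * ‖X.u τ y‖) = (d / 2) ^ 2 * (4 * (cylRadius y * ‖X.u τ y‖)) := by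
    ring
  rw [h2] at h1
  exact le_of_mul_le_mul_left h1 hd2

/-! ## §3 The sequence of axis zoom data -/

/-- **AXIS ZOOM DATA, WITH THE CLAY FORCE** (no named fact; any `ν`; axisymmetric slices, `x₁` ON the
axis): if `|x'|‖u‖` is unbounded on `[t_b, T) × B(x₁, r'/2)`, there are times `τ_k ∈ [t_b, T)` and
centres `y_k ∈ B(x₁, r')` on the meridian half-plane (`(y_k)₁ = 0 ≤ (y_k)₀ = |y_k'|`) with, writing
`d_k = r' − |y_k − x₁|`, `r_k = |y_k'|`, `m_k = ‖u(τ_k, y_k)‖`: `k + 1 ≤ d_k² · r_k · m_k`;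
`0 < r_k ≤ ‖y_k − x₁‖ < r'`; `0 < m_k`; the maximality over `[t_b, τ_k] × B̄(x₁, r')`; and KNSS's
bound `|z'|‖u(s, z)‖ ≤ 4 r_k m_k` on `[t_b, τ_k] × B(y_k, d_k/2)`.
[cite: KochNadirashviliSereginSverak2009, proof of Thm 6.2 (arXiv pp. 12–13)] -/
theorem exists_axis_zoom_data (hax : ∀ t ∈ Ico 0 X.T, IsAxisymmetric (X.u t))
    {x₁ : EuclideanSpace ℝ (Fin 3)} (hx₁ : cylRadius x₁ = 0) {r' t_b : ℝ} (hr' : 0 < r')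
    (ht_b : t_b ∈ Ico 0 X.T)
    (hunb : ∀ L : ℝ, ∃ s ∈ Ico t_b X.T, ∃ z ∈ ball x₁ (r' / 2), L < cylRadius z * ‖X.u s z‖) :
    ∃ (τ : ℕ → ℝ) (y : ℕ → EuclideanSpace ℝ (Fin 3)), ∀ k : ℕ,
      τ k ∈ Ico t_b X.T ∧ y k ∈ ball x₁ r' ∧ (y k 1 = 0 ∧ 0 ≤ y k 0) ∧
      cylRadius (y k) = y k 0 ∧ 0 < cylRadius (y k) ∧ cylRadius (y k) ≤ dist (y k) x₁ ∧
      0 < ‖X.u (τ k) (y k)‖ ∧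
      (k : ℝ) + 1 ≤ (r' - dist (y k) x₁) ^ 2 * (cylRadius (y k) * ‖X.u (τ k) (y k)‖) ∧
      (∀ s ∈ Icc t_b (τ k), ∀ z ∈ closedBall x₁ r',
        (r' - dist z x₁) ^ 2 * (cylRadius z * ‖X.u s z‖) ≤
          (r' - dist (y k) x₁) ^ 2 * (cylRadius (y k) * ‖X.u (τ k) (y k)‖)) ∧
      (∀ s ∈ Icc t_b (τ k), ∀ z ∈ ball (y k) ((r' - dist (y k) x₁) / 2),
        cylRadius z * ‖X.u s z‖ ≤ 4 * (cylRadius (y k) * ‖X.u (τ k) (y k)‖)) := by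
  have hsel := fun k : ℕ =>
    X.exists_axisWeighted_max_halfPlane hax hx₁ hr' ht_b hunb ((k : ℝ) + 1)
  choose τ hτ y hy hhalf hL hmax using hsel
  refine ⟨τ, y, fun k => ⟨hτ k, hy k, hhalf k, cylRadius_eq_apply_zero (hhalf k).1 (hhalf k).2,
    ?_, ?_, ?_, hL k, hmax k, fun s hs z hz => X.cylRadius_mul_norm_le_four_mul (hy k) (hmax k) hs hz⟩⟩
  · -- `0 < r_k`: the product `d_k² r_k m_k ≥ k + 1 > 0`
    have hpos : 0 < (r' - dist (y k) x₁) ^ 2 * (cylRadius (y k) * ‖X.u (τ k) (y k)‖) :=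
      lt_of_lt_of_le (by positivity) (hL k)
    rcases (cylRadius_nonneg (y k)).lt_or_eq with h | h
    · exact h
    · exfalso; rw [← h, zero_mul, mul_zero] at hpos; exact lt_irrefl 0 hpos
  · rw [dist_eq_norm]; exact cylRadius_le_norm_sub_of_axis hx₁ (y k)
  · have hpos : 0 < (r' - dist (y k) x₁) ^ 2 * (cylRadius (y k) * ‖X.u (τ k) (y k)‖) :=
      lt_of_lt_of_le (by positivity) (hL k)
    rcases (norm_nonneg (X.u (τ k) (y k))).lt_or_eq with h | h
    · exact h
    · exfalso; rw [← h, mul_zero, mul_zero] at hpos; exact lt_irrefl 0 hpos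

end ClayBlowup

end Summit.NavierStokesRegularity.FluidComputer

end
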